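import Literature.Probability.Percolation.Z2PivotalJointSubseqLimit
import Literature.Probability.Distributions.RieszMarkovKernelMeasurable

/-!
# Crux `FlipErgodicityZ2` (stmt-CriticalPhenomena-14825), line `registered`, stub
# `stub_jointKernelLimit`: node N1abc — kernels on a countable cutoff set from the graph property

Route `Summits/CriticalPhenomena/CardyFormulaZ2/Theses/CardyMeckeFlip`.  Helper file (supports the
crux item).  The registered stub `stub_jointKernelLimit` (Garban–Pete–Schramm 2013 Thm. 4.3/§4.7
for bond-`ℤ²`: a joint multi-cutoff limit `(ω_δ, (μ^{εⱼ}_δ)ⱼ) ⇒ (S, (M εⱼ S)ⱼ)` with a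
measurable locally integrable kernel) splits into the LANDED tightness/Prokhorov node N1a
(`exists_subseq_jointLaw_z2PivotalMeasure`), the UNPRINTED graph property N1b (every
subsequential joint limit law `ν` of `(ω_δ, (⟨μ^{εᵢ}_δ, φᵢ⟩)ᵢ)` is `(S ↦ (S, T S))_* μ` with `T`
measurable — GPS13 Prop. 4.1/4.5, Lemma 4.6 for `ℤ²`), the LANDED Riesz–Markov kernel node N1c
(`exists_measurable_kernel_integral_eq_ae_on_dominatedDense`) and glue.  This file proves the
composition **N1abc from the graph property**:

  `jointGraphLimit_on_testFamily` — given (B2) and N1b (as a hypothesis, verbatim), a mesh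
  sequence `δ_k → 0⁺` realising `μ`, a countable rationally stable dominated-dense test family
  `𝓓 ⊆ C_c(ℂ)` and a countable set `A` of positive cutoffs: along a subsequence there are
  measurable kernels `M ε : ℋ → Measure ℂ`, finite on compact sets for every `S`, locally
  `μ`-integrable for `ε ∈ A`, with the joint GRAPH convergence
  `E G(ω_δ, (⟨μ^ε_δ, g⟩)_{(ε,g) ∈ A × 𝓓}) → ∫ G(S, (⟨M ε S, g⟩)_{(ε,g)}) dμ` for every bounded
  continuous `G` on `ℋ × ℝ^{A × 𝓓}`.

Proof.  N1a gives a subsequence and a limit LAW `ν`; N1b turns it into a graph `ν = (S, T S)_* μ`;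
the exact lattice identities `⟨μ^ε_δ, f + g⟩ = ⟨μ^ε_δ, f⟩ + ⟨μ^ε_δ, g⟩`,
`⟨μ^ε_δ, q f⟩ = q ⟨μ^ε_δ, f⟩`, `⟨μ^ε_δ, f⟩ ≥ 0` (`f ≥ 0`) are closed constraints, hence hold
`ν`-a.s. (`ae_mem_of_isClosed_of_tendsto_law`), i.e. `T S (ε, ·)` is a.s. additive,
`ℚ`-homogeneous and positive on `𝓓`; N1c represents it by a measurable kernel; local
integrability from the inherited second moments (`t ≤ t² + 1`) and the cutoffs `χ_K ∈ 𝓓`.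
-/

noncomputable section

open MeasureTheory Set Filter Metric Function
open Literature.Probability.Percolation Literature.Probability.Percolation.QuadCrossing
open Literature.Probability.LatticeModels Literature.Probability.Distributions
open scoped ENNReal Topology BoundedContinuousFunction CompactlySupported

namespace Summit.CriticalPhenomena.CardyFormulaZ2.Theorems.CardyMeckeFlip

/-! ### Lattice identities -/

/-- `⟨μ^ε_δ(ω), f + g⟩ = ⟨μ^ε_δ(ω), f⟩ + ⟨μ^ε_δ(ω), g⟩` for `f, g ∈ C_c(ℂ)` (`δ > 0`). [folklore] -/
theorem integral_z2PivotalMeasure_add (ε : ℝ) {δ : ℝ} (hδ : 0 < δ) (ω : BondConfig (Site 2))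
    (f g : C_c(ℂ, ℝ)) :
    ∫ x, (f + g) x ∂(z2PivotalMeasure ε δ ω) =
      ∫ x, f x ∂(z2PivotalMeasure ε δ ω) + ∫ x, g x ∂(z2PivotalMeasure ε δ ω) := by
  haveI := isFiniteMeasureOnCompacts_z2PivotalMeasure ε hδ ω
  simp only [CompactlySupportedContinuousMap.coe_add, Pi.add_apply]
  exact integral_add f.integrable g.integrable

/-- `⟨μ^ε_δ(ω), q • f⟩ = q ⟨μ^ε_δ(ω), f⟩` for `f ∈ C_c(ℂ)`. [folklore] -/
theorem integral_z2PivotalMeasure_smul (ε δ : ℝ) (ω : BondConfig (Site 2)) (q : ℝ)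
    (f : C_c(ℂ, ℝ)) :
    ∫ x, (q • f) x ∂(z2PivotalMeasure ε δ ω) = q * ∫ x, f x ∂(z2PivotalMeasure ε δ ω) := by
  simp only [CompactlySupportedContinuousMap.coe_smul, Pi.smul_apply, smul_eq_mul]
  exact integral_const_mul q _

/-- `t ≤ t² + 1` in `[0, ∞]`: `ofReal t ≤ ofReal (t ^ 2) + 1`. [folklore] -/
theorem ofReal_le_ofReal_sq_add_one (t : ℝ) :
    ENNReal.ofReal t ≤ ENNReal.ofReal (t ^ 2) + 1 := by
  calc ENNReal.ofReal t ≤ ENNReal.ofReal (t ^ 2 + 1) :=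
        ENNReal.ofReal_le_ofReal (by nlinarith [sq_nonneg (t - 1)])
    _ ≤ ENNReal.ofReal (t ^ 2) + ENNReal.ofReal 1 := ENNReal.ofReal_add_le
    _ = ENNReal.ofReal (t ^ 2) + 1 := by rw [ENNReal.ofReal_one]

/-! ### N1abc from the graph property -/

/-- **Node N1abc of stub `stub_jointKernelLimit` from the graph property N1b.**  Assume the
uniform second moments (B2) and the graph property N1b (second hypothesis, verbatim the unprinted
node: every subsequential joint limit law of a configuration with the integrals of countably
many test functions against its averaged pivotal measures, along a mesh sequence realising `μ`,
is the push-forward of `μ` along a measurable graph).  Let `δ_k → 0⁺` realise `μ`, let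
`𝓓 ⊆ C_c(ℂ, ℝ)` be countable, closed under `+` and rational multiples and dominated-dense, and
let `A` be a countable set of positive cutoffs.  Then along a subsequence `ψ` there are kernels
`M ε : ℋ → Measure ℂ` (all `ε`; `M ε = 0` off `A`), each measurable and finite on compact sets
for every `S`, with `∫⁻ M ε S (closedBall 0 r) dμ < ∞` for `ε ∈ A`, such that for every
bounded continuous `G` on `ℋ × ℝ^{A × 𝓓}`,
`E G(ω_{δ_{ψ k}}, (⟨μ^ε_{δ_{ψ k}}, g⟩)_{(ε, g)}) → ∫ G(S, (∫ g d(M ε S))_{(ε, g)}) dμ(S)`.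
[folklore] -/
theorem jointGraphLimit_on_testFamily
    (hmom : ∀ ε : ℝ, 0 < ε → ∀ φ : ℂ → ℝ, Continuous φ → HasCompactSupport φ →
      ∃ C δ₀ : ℝ, 0 < δ₀ ∧ ∀ δ : ℝ, 0 < δ → δ ≤ δ₀ →
        ∫ ω, (∫ x, |φ x| ∂(z2PivotalMeasure ε δ ω)) ^ 2 ∂(bondPercolation (zdGraph 2) half) ≤ C)
    (hgraph : (∀ ε : ℝ, 0 < ε → ∀ φ : ℂ → ℝ, Continuous φ → HasCompactSupport φ →
      ∃ C δ₀ : ℝ, 0 < δ₀ ∧ ∀ δ : ℝ, 0 < δ → δ ≤ δ₀ →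
        ∫ ω, (∫ x, |φ x| ∂(z2PivotalMeasure ε δ ω)) ^ 2 ∂(bondPercolation (zdGraph 2) half) ≤ C) →
      ∀ (μ : FiniteMeasure (QuadConfig (Set.univ : Set ℂ))) (δs : ℕ → ℝ), (∀ k, 0 < δs k) →
        Tendsto δs atTop (𝓝 0) →
          Tendsto (fun k => z2QuadLaw (Set.univ : Set ℂ) (δs k)) atTop (𝓝 μ) →
            ∀ (ι : Type), Countable ι → ∀ (ε : ι → ℝ), (∀ i, 0 < ε i) → ∀ (φ : ι → ℂ → ℝ),
              (∀ i, Continuous (φ i)) → (∀ i, HasCompactSupport (φ i)) →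
                ∀ (ν : Measure (QuadConfig (Set.univ : Set ℂ) × (ι → ℝ))), IsProbabilityMeasure ν →
                  (∀ G : BoundedContinuousFunction (QuadConfig (Set.univ : Set ℂ) × (ι → ℝ)) ℝ,
                    Tendsto (fun k => ∫ ω, G (z2QuadConfig (Set.univ : Set ℂ) (δs k) ω,
                        fun i => ∫ x, φ i x ∂(z2PivotalMeasure (ε i) (δs k) ω))
                      ∂(bondPercolation (zdGraph 2) half)) atTop (𝓝 (∫ p, G p ∂ν))) →
                  ∃ T : QuadConfig (Set.univ : Set ℂ) → ι → ℝ, Measurable T ∧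
                    ν = (μ : Measure (QuadConfig (Set.univ : Set ℂ))).map (fun S => (S, T S)))
    (μ : FiniteMeasure (QuadConfig (univ : Set ℂ))) (δs : ℕ → ℝ) (hpos : ∀ k, 0 < δs k)
    (h0 : Tendsto δs atTop (𝓝 0))
    (hlaw : Tendsto (fun k => z2QuadLaw (univ : Set ℂ) (δs k)) atTop (𝓝 μ))
    {𝓓 : Set C_c(ℂ, ℝ)} (h𝓓c : 𝓓.Countable) (hadd : ∀ f ∈ 𝓓, ∀ g ∈ 𝓓, f + g ∈ 𝓓)
    (hsmul : ∀ (q : ℚ), ∀ f ∈ 𝓓, (q : ℝ) • f ∈ 𝓓)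
    (hdense : ∀ K : Set ℂ, IsCompact K → ∃ χ ∈ 𝓓, (∀ x, χ x ∈ Icc (0 : ℝ) 1) ∧ (∀ x ∈ K, χ x = 1) ∧
      ∀ f : C_c(ℂ, ℝ), support f ⊆ K → ∀ η : ℝ, 0 < η → ∃ g ∈ 𝓓, ∀ x, |f x - g x| ≤ η * χ x)
    {A : Set ℝ} (hA : A.Countable) (hApos : ∀ ε ∈ A, 0 < ε) :
    ∃ ψ : ℕ → ℕ, StrictMono ψ ∧ ∃ M : ℝ → QuadConfig (univ : Set ℂ) → Measure ℂ,
      (∀ ε, Measurable (M ε)) ∧ (∀ ε S, IsFiniteMeasureOnCompacts (M ε S)) ∧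
      (∀ ε ∈ A, ∀ r : ℝ,
        ∫⁻ S, M ε S (closedBall 0 r) ∂(μ : Measure (QuadConfig (univ : Set ℂ))) < ⊤) ∧
      ∀ G : (QuadConfig (univ : Set ℂ) × (A × 𝓓 → ℝ)) →ᵇ ℝ,
        Tendsto (fun k => ∫ ω, G (z2QuadConfig (univ : Set ℂ) (δs (ψ k)) ω,
            fun p => ∫ x, (p.2 : C_c(ℂ, ℝ)) x ∂(z2PivotalMeasure (p.1 : ℝ) (δs (ψ k)) ω))
          ∂(bondPercolation (zdGraph 2) half)) atTop
          (𝓝 (∫ S, G (S, fun p => ∫ x, (p.2 : C_c(ℂ, ℝ)) x ∂(M (p.1 : ℝ) S))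
            ∂(μ : Measure (QuadConfig (univ : Set ℂ))))) := by
  classical
  -- `ℋ` is compact metrisable (Schramm–Smirnov Thm. 1.4)
  haveI : T2Space (QuadConfig (univ : Set ℂ)) :=
    (SchrammSmirnov2011_thm_1_4_holds univ isOpen_univ univ_nonempty).1.2.2
  haveI : CompactSpace (QuadConfig (univ : Set ℂ)) := QuadConfig.compactSpace
  haveI : TopologicalSpace.MetrizableSpace (QuadConfig (univ : Set ℂ)) :=
    (SchrammSmirnov2011_thm_1_4_holds univ isOpen_univ univ_nonempty).1.2.1
  haveI : SecondCountableTopology (QuadConfig (univ : Set ℂ)) := by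
    letI := TopologicalSpace.metrizableSpaceMetric (QuadConfig (univ : Set ℂ))
    infer_instance
  haveI : Countable A := hA.to_subtype
  haveI : Countable 𝓓 := h𝓓c.to_subtype
  -- N1a: a subsequence and a joint limit law
  obtain ⟨ψ, hψ, ν, hν, -, hνmom, hconv⟩ := exists_subseq_jointLaw_z2PivotalMeasure hmom μ hpos h0
    hlaw (ι := A × 𝓓) (ε := fun p => (p.1 : ℝ)) (fun p => hApos _ p.1.2)
    (φ := fun p => ⇑(p.2 : C_c(ℂ, ℝ))) (fun p => (p.2 : C_c(ℂ, ℝ)).continuous)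
    (fun p => (p.2 : C_c(ℂ, ℝ)).hasCompactSupport)
  -- N1b: the limit law is a graph
  have hpos' : ∀ k, 0 < δs (ψ k) := fun k => hpos _
  have h0' : Tendsto (fun k => δs (ψ k)) atTop (𝓝 0) := h0.comp hψ.tendsto_atTop
  have hlaw' : Tendsto (fun k => z2QuadLaw (univ : Set ℂ) (δs (ψ k))) atTop (𝓝 μ) :=
    hlaw.comp hψ.tendsto_atTop
  obtain ⟨T, hTm, hνT⟩ := hgraph hmom μ (fun k => δs (ψ k)) hpos' h0' hlaw' (A × 𝓓) inferInstance
    (fun p => (p.1 : ℝ)) (fun p => hApos _ p.1.2) (fun p => ⇑(p.2 : C_c(ℂ, ℝ)))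
    (fun p => (p.2 : C_c(ℂ, ℝ)).continuous) (fun p => (p.2 : C_c(ℂ, ℝ)).hasCompactSupport) ν hν
    hconv
  have hgm : Measurable fun S : QuadConfig (univ : Set ℂ) => (S, T S) := measurable_id.prodMk hTm
  have hTi : ∀ i, Measurable fun S => T S i := fun i => (measurable_pi_apply i).comp hTm
  -- closed constraints: `ν`-a.s., hence `μ`-a.s. along the graph
  have hclosed : ∀ {R : Set (QuadConfig (univ : Set ℂ) × (A × 𝓓 → ℝ))}, IsClosed R →
      (∀ k ω, (z2QuadConfig (univ : Set ℂ) (δs (ψ k)) ω, fun p : A × 𝓓 =>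
        ∫ x, (p.2 : C_c(ℂ, ℝ)) x ∂(z2PivotalMeasure (p.1 : ℝ) (δs (ψ k)) ω)) ∈ R) →
      ∀ᵐ S ∂(μ : Measure (QuadConfig (univ : Set ℂ))), (S, T S) ∈ R := by
    intro R hR hmem
    have h : ∀ᵐ p ∂ν, p ∈ R :=
      ae_mem_of_isClosed_of_tendsto_law hconv hR (Eventually.of_forall fun k => ae_of_all _ (hmem k))
    rw [hνT] at h
    exact ae_of_ae_map hgm.aemeasurable h
  have hcont : ∀ i : A × 𝓓, Continuous fun p : QuadConfig (univ : Set ℂ) × (A × 𝓓 → ℝ) => p.2 i :=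
    fun i => (continuous_apply i).comp continuous_snd
  -- the three a.s. properties of `T S (ε, ·)` on `𝓓`
  have hTadd : ∀ᵐ S ∂(μ : Measure (QuadConfig (univ : Set ℂ))), ∀ (a : A) (f g : 𝓓),
      T S (a, ⟨(f : C_c(ℂ, ℝ)) + g, hadd _ f.2 _ g.2⟩) = T S (a, f) + T S (a, g) := by
    refine ae_all_iff.2 fun a => ae_all_iff.2 fun f => ae_all_iff.2 fun g => ?_
    have h := hclosed (isClosed_eq (hcont (a, ⟨(f : C_c(ℂ, ℝ)) + g, hadd _ f.2 _ g.2⟩))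
      ((hcont (a, f)).add (hcont (a, g)))) fun k ω =>
      integral_z2PivotalMeasure_add _ (hpos _) ω f g
    exact h
  have hThom : ∀ᵐ S ∂(μ : Measure (QuadConfig (univ : Set ℂ))), ∀ (a : A) (q : ℚ) (f : 𝓓),
      T S (a, ⟨((q : ℝ) • (f : C_c(ℂ, ℝ))), hsmul q _ f.2⟩) = (q : ℝ) * T S (a, f) := by
    refine ae_all_iff.2 fun a => ae_all_iff.2 fun q => ae_all_iff.2 fun f => ?_
    exact hclosed (isClosed_eq (hcont (a, ⟨((q : ℝ) • (f : C_c(ℂ, ℝ))), hsmul q _ f.2⟩))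
      ((hcont (a, f)).const_smul (q : ℝ))) fun k ω =>
      integral_z2PivotalMeasure_smul _ _ ω q f
  have hTpos : ∀ᵐ S ∂(μ : Measure (QuadConfig (univ : Set ℂ))), ∀ (a : A) (f : 𝓓),
      (∀ x, 0 ≤ (f : C_c(ℂ, ℝ)) x) → 0 ≤ T S (a, f) := by
    refine ae_all_iff.2 fun a => ae_all_iff.2 fun f => ?_
    by_cases hf0 : ∀ x, 0 ≤ (f : C_c(ℂ, ℝ)) x
    · have h := hclosed (isClosed_le continuous_const (hcont (a, f))) fun k ω => by
        simp only [mem_setOf_eq]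
        exact integral_nonneg fun x => hf0 x
      exact h.mono fun S hS _ => hS
    · exact ae_of_all _ fun S h => absurd h hf0
  -- N1c at each cutoff of `A`
  have hker : ∀ a : A, ∃ Ma : QuadConfig (univ : Set ℂ) → Measure ℂ, Measurable Ma ∧
      (∀ S (K : Set ℂ), IsCompact K → Ma S K < ⊤) ∧
      ∀ᵐ S ∂(μ : Measure (QuadConfig (univ : Set ℂ))), ∀ f : 𝓓,
        ∫ x, (f : C_c(ℂ, ℝ)) x ∂(Ma S) = T S (a, f) := by
    intro a
    set TT : QuadConfig (univ : Set ℂ) → C_c(ℂ, ℝ) → ℝ := fun S f =>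
      if hf : f ∈ 𝓓 then T S (a, ⟨f, hf⟩) else 0 with hTT
    have hTTmem : ∀ S, ∀ f (hf : f ∈ 𝓓), TT S f = T S (a, ⟨f, hf⟩) := fun S f hf => dif_pos hf
    have hTTmeas : ∀ f ∈ 𝓓, Measurable fun S => TT S f := fun f hf => by
      simp only [hTT, hf, dif_pos]
      exact hTi _
    obtain ⟨Ma, hMam, -, hMafin, hMa⟩ :=
      exists_measurable_kernel_integral_eq_ae_on_dominatedDense
        (μ : Measure (QuadConfig (univ : Set ℂ))) hadd hsmul hdense (T := TT) hTTmeas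
        (by
          filter_upwards [hTadd] with S hS f hf g hg
          rw [hTTmem S _ (hadd f hf g hg), hTTmem S f hf, hTTmem S g hg]
          exact hS a ⟨f, hf⟩ ⟨g, hg⟩)
        (by
          filter_upwards [hThom] with S hS q f hf
          rw [hTTmem S _ (hsmul q f hf), hTTmem S f hf]
          exact hS a q ⟨f, hf⟩)
        (by
          filter_upwards [hTpos] with S hS f hf hf0
          rw [hTTmem S f hf]
          exact hS a ⟨f, hf⟩ hf0)
    refine ⟨Ma, hMam, hMafin, ?_⟩
    filter_upwards [hMa] with S hS f
    rw [hS f f.2, hTTmem S f f.2]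
  choose Ma hMam hMafin hMa using hker
  -- the kernel family
  set M : ℝ → QuadConfig (univ : Set ℂ) → Measure ℂ := fun ε S =>
    if h : ε ∈ A then Ma ⟨ε, h⟩ S else 0 with hMdef
  have hMA : ∀ a : A, M a = Ma a := fun a => by
    funext S
    simp only [hMdef, Subtype.coe_prop, dif_pos, Subtype.coe_eta]
  have hMoff : ∀ ε, ε ∉ A → M ε = fun _ => 0 := fun ε hε => by
    funext S
    simp only [hMdef, hε, dif_neg, not_false_eq_true]
  refine ⟨ψ, hψ, M, fun ε => ?_, fun ε S => ?_, fun ε hε r => ?_, fun G => ?_⟩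
  · -- measurable
    by_cases hε : ε ∈ A
    · rw [show ε = ((⟨ε, hε⟩ : A) : ℝ) from rfl, hMA]
      exact hMam _
    · rw [hMoff ε hε]
      exact measurable_const
  · -- finite on compacts
    by_cases hε : ε ∈ A
    · rw [show ε = ((⟨ε, hε⟩ : A) : ℝ) from rfl, hMA]
      exact ⟨fun K hK => hMafin _ S K hK⟩
    · rw [hMoff ε hε]
      infer_instance
  · -- locally integrable on `A`
    set a : A := ⟨ε, hε⟩
    rw [show ε = (a : ℝ) from rfl, hMA]
    obtain ⟨χ, hχ, hχ01, hχ1, -⟩ := hdense (closedBall (0 : ℂ) r) (isCompact_closedBall 0 r)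
    set i : A × 𝓓 := (a, ⟨χ, hχ⟩)
    obtain ⟨C, hC⟩ := hνmom i
    have h1 : ∀ S, Ma a S (closedBall 0 r) ≤ ENNReal.ofReal (∫ x, χ x ∂(Ma a S)) := fun S => by
      haveI : IsFiniteMeasureOnCompacts (Ma a S) := ⟨fun K hK => hMafin a S K hK⟩
      rw [ofReal_integral_eq_lintegral_ofReal χ.integrable (ae_of_all _ fun x => (hχ01 x).1),
        ← lintegral_indicator_one measurableSet_closedBall]
      refine lintegral_mono fun x => ?_
      by_cases hx : x ∈ closedBall (0 : ℂ) r
      · rw [indicator_of_mem hx, Pi.one_apply, hχ1 x hx, ENNReal.ofReal_one]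
      · rw [indicator_of_notMem hx]
        exact zero_le
    have h2 : ∀ᵐ S ∂(μ : Measure (QuadConfig (univ : Set ℂ))),
        ENNReal.ofReal (∫ x, χ x ∂(Ma a S)) ≤ ENNReal.ofReal ((T S i) ^ 2) + 1 := by
      filter_upwards [hMa a] with S hS
      rw [hS ⟨χ, hχ⟩]
      exact ofReal_le_ofReal_sq_add_one _
    have h3 : ∫⁻ S, ENNReal.ofReal ((T S i) ^ 2) ∂(μ : Measure (QuadConfig (univ : Set ℂ))) ≤
        ENNReal.ofReal C := by
      have hVm : Measurable fun p : QuadConfig (univ : Set ℂ) × (A × 𝓓 → ℝ) =>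
          ENNReal.ofReal ((p.2 i) ^ 2) :=
        (((measurable_pi_apply i).comp measurable_snd).pow_const 2).ennreal_ofReal
      have h := hC
      rw [hνT, lintegral_map hVm hgm] at h
      exact h
    calc ∫⁻ S, Ma a S (closedBall 0 r) ∂(μ : Measure (QuadConfig (univ : Set ℂ)))
        ≤ ∫⁻ S, ENNReal.ofReal (∫ x, χ x ∂(Ma a S)) ∂(μ : Measure (QuadConfig (univ : Set ℂ))) :=
          lintegral_mono fun S => h1 S
      _ ≤ ∫⁻ S, ENNReal.ofReal ((T S i) ^ 2) + 1 ∂(μ : Measure (QuadConfig (univ : Set ℂ))) :=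
          lintegral_mono_ae h2
      _ = ∫⁻ S, ENNReal.ofReal ((T S i) ^ 2) ∂(μ : Measure (QuadConfig (univ : Set ℂ))) +
            (μ : Measure (QuadConfig (univ : Set ℂ))) univ := by
          rw [lintegral_add_right _ measurable_const, lintegral_one]
      _ < ⊤ := by
          refine ENNReal.add_lt_top.2 ⟨h3.trans_lt ENNReal.ofReal_lt_top, measure_lt_top _ _⟩
  · -- the joint graph convergence
    have h := hconv G
    rw [hνT, integral_map hgm.aemeasurable G.continuous.aestronglyMeasurable] at h
    have hae : ∀ᵐ S ∂(μ : Measure (QuadConfig (univ : Set ℂ))),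
        G (S, T S) = G (S, fun p => ∫ x, (p.2 : C_c(ℂ, ℝ)) x ∂(M (p.1 : ℝ) S)) := by
      filter_upwards [ae_all_iff.2 hMa] with S hS
      have e : T S = fun p : A × 𝓓 => ∫ x, (p.2 : C_c(ℂ, ℝ)) x ∂(M (p.1 : ℝ) S) :=
        funext fun p => by rw [hMA p.1, hS p.1 p.2]
      rw [e]
    rw [integral_congr_ae hae] at h
    exact h


/-- **Node N1abc of stub `stub_jointKernelLimit` from the graph property N1b** — the registered
helper headline in closed form (uniform second moments (B2), then the graph property N1b, then a
mesh sequence realising `μ`, a countable rationally stable dominated-dense test family `𝓓` and a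
countable set `A` of positive cutoffs give, along a subsequence, measurable kernels, finite on
compacts, locally integrable on `A`, with the joint graph convergence on `A × 𝓓`); see
`jointGraphLimit_on_testFamily` for the proof with named hypotheses. [folklore] -/
theorem nodeN1abc_of_graphProperty :
    (∀ ε : ℝ, 0 < ε → ∀ φ : ℂ → ℝ, Continuous φ → HasCompactSupport φ → ∃ C δ₀ : ℝ, 0 < δ₀ ∧
      ∀ δ : ℝ, 0 < δ → δ ≤ δ₀ → ∫ ω, (∫ x,
      |φ x| ∂(z2PivotalMeasure ε δ ω)) ^ 2 ∂(bondPercolation (zdGraph 2) half) ≤ C) → ((∀ ε : ℝ,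
      0 < ε → ∀ φ : ℂ → ℝ, Continuous φ → HasCompactSupport φ → ∃ C δ₀ : ℝ, 0 < δ₀ ∧ ∀ δ : ℝ,
      0 < δ → δ ≤ δ₀ → ∫ ω, (∫ x, |φ x| ∂(z2PivotalMeasure ε δ ω)) ^ 2 ∂(bondPercolation (zdGraph
      2) half) ≤ C) → ∀ (μ : FiniteMeasure (QuadConfig (Set.univ : Set ℂ))) (δs : ℕ → ℝ), (∀ k,
      0 < δs k) → Tendsto δs atTop (𝓝 0) →
      Tendsto (fun k => z2QuadLaw (Set.univ : Set ℂ) (δs k)) atTop (𝓝 μ) → ∀ (ι : Type),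
      Countable ι → ∀ (ε : ι → ℝ), (∀ i, 0 < ε i) → ∀ (φ : ι → ℂ → ℝ), (∀ i, Continuous (φ i)) →
      (∀ i, HasCompactSupport (φ i)) → ∀ (ν : Measure (QuadConfig (Set.univ : Set ℂ) × (ι → ℝ))),
      IsProbabilityMeasure ν → (∀ G : BoundedContinuousFunction (QuadConfig (Set.univ : Set ℂ) ×
      (ι → ℝ)) ℝ, Tendsto (fun k => ∫ ω, G (z2QuadConfig (Set.univ : Set ℂ) (δs k) ω,
      fun i => ∫ x, φ i x ∂(z2PivotalMeasure (ε i) (δs k) ω)) ∂(bondPercolation (zdGraph 2) half))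
      atTop (𝓝 (∫ p, G p ∂ν))) → ∃ T : QuadConfig (Set.univ : Set ℂ) → ι → ℝ, Measurable T ∧
      ν = (μ : Measure (QuadConfig (Set.univ : Set ℂ))).map (fun S => (S, T S))) →
      ∀ (μ : FiniteMeasure (QuadConfig (Set.univ : Set ℂ))) (δs : ℕ → ℝ), (∀ k, 0 < δs k) →
      Tendsto δs atTop (𝓝 0) → Tendsto (fun k => z2QuadLaw (Set.univ : Set ℂ) (δs k)) atTop (𝓝 μ)
      → ∀ (𝓓 : Set (CompactlySupportedContinuousMap ℂ ℝ)), 𝓓.Countable → (∀ f ∈ 𝓓, ∀ g ∈ 𝓓,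
      f + g ∈ 𝓓) → (∀ (q : ℚ), ∀ f ∈ 𝓓, (q : ℝ) • f ∈ 𝓓) → (∀ K : Set ℂ, IsCompact K → ∃ χ ∈ 𝓓,
      (∀ x, χ x ∈ Set.Icc (0 : ℝ) 1) ∧ (∀ x ∈ K, χ x = 1) ∧
      ∀ f : CompactlySupportedContinuousMap ℂ ℝ, Function.support f ⊆ K → ∀ η : ℝ, 0 < η →
      ∃ g ∈ 𝓓, ∀ x, |f x - g x| ≤ η * χ x) → ∀ (A : Set ℝ), A.Countable → (∀ ε ∈ A, 0 < ε) →
      ∃ ψ : ℕ → ℕ, StrictMono ψ ∧ ∃ M : ℝ → QuadConfig (Set.univ : Set ℂ) → Measure ℂ, (∀ ε,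
      Measurable (M ε)) ∧ (∀ ε S, IsFiniteMeasureOnCompacts (M ε S)) ∧ (∀ ε ∈ A, ∀ r : ℝ, ∫⁻ S,
      M ε S (Metric.closedBall 0 r) ∂(μ : Measure (QuadConfig (Set.univ : Set ℂ))) < ⊤) ∧
      ∀ G : BoundedContinuousFunction (QuadConfig (Set.univ : Set ℂ) × (A × 𝓓 → ℝ)) ℝ,
      Tendsto (fun k => ∫ ω, G (z2QuadConfig (Set.univ : Set ℂ) (δs (ψ k)) ω, fun p => ∫ x,
      (p.2 : CompactlySupportedContinuousMap ℂ ℝ) x ∂(z2PivotalMeasure (p.1 : ℝ) (δs (ψ k)) ω))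
      ∂(bondPercolation (zdGraph 2) half)) atTop (𝓝 (∫ S, G (S, fun p => ∫ x,
      (p.2 : CompactlySupportedContinuousMap ℂ ℝ) x ∂(M (p.1 : ℝ) S)) ∂(μ : Measure (QuadConfig
      (Set.univ : Set ℂ))))) := by
  intro hmom hgraph μ δs hpos h0 hlaw 𝓓 h𝓓c hadd hsmul hdense A hA hApos
  exact jointGraphLimit_on_testFamily hmom hgraph μ δs hpos h0 hlaw h𝓓c hadd hsmul hdense hA hApos

end Summit.CriticalPhenomena.CardyFormulaZ2.Theorems.CardyMeckeFlip

end
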